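/-
Copyright (c) 2026. All rights reserved.
Released under Apache 2.0 license as described in the file LICENSE.
-/
import Literature.AlgebraicGeometry.ComplexMultiplication.HyperellipticJacobianTwentyFourDvdLevel
import HarnessLib

/-!
# GGL 2024 Thm. 3.0 + Lemma 14 at the levels `20 ∣ m`, `3 ∤ m`:
# `End⁰(J_m) ≅ Mat₄(ℚ(√−5)) × ℚ(i) × ∏_{d ∣ m odd, d ≠ 1} Mat₂(ℚ(ζ_d)) × ∏_{4 ∣ e ∣ m, e ∉ {4, 20}} Mat₂(ℚ(ζ_e − ζ_e⁻¹))`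

Layer `Literature/AlgebraicGeometry/ComplexMultiplication`, namespace `…ComplexMultiplication.HyperellipticJacobian`; the family-form assembly of
`HyperellipticJacobianGenericCompositeLevel` (F24) with the exceptional block `Y_{20}` (`End⁰(X_{20}) ≅ Mat₄(F_{20})`, `F_{20} = ℚ(√−5)`, F9 ∕ F16)
prepended.  THEOREMS ONLY (no definition, no named fact, no `sorry`, no instance).

## The print

A. Gallese, H. Goodson, D. Lombardo, arXiv:2405.20394 [GalleseGoodsonLombardo2024] (held `paper:arxiv-2405.20394`, p0012, p0014, p0015): THM. 3.0
«`J_m ∼ ∏_{d ∣ m, d ≠ 1,2} X_d`», (4), (5), «`X_{20} ∼ Y_{20}⁴`», the last statement; §3.4 (`F_{20} = ℚ(√−5)`); §3.5 LEMMA 14 with the sentence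
following it.  When `20 ∣ m` and `3 ∤ m` (so `12, 24, 60 ∤ m`) the divisors `d ∉ {1, 2}` of `m` are: `20` (block `Mat₄(ℚ(√−5))`); `4` (`ℚ(i)`); the pairs
`{d, 2d}` over the odd divisors `d ≠ 1`; and the `e` with `4 ∣ e`, `e ∉ {4, 20}` — all non-exceptional, pairwise orthogonal `Y`-blocks — so
`End⁰(J_m) ≅ Mat₄(ℚ(√−5)) × ℚ(ζ_4) × ∏_d Mat₂(ℚ(ζ_d)) × ∏_e Mat₂(ℚ(ζ_e − ζ_e⁻¹))`, of dimension `34 + 4 Σ_d φ(d) + 2 Σ_e φ(e)`, and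
`2 dim J_m = 10 + 2 Σ_d φ(d) + Σ_e φ(e)` (`m = 20`: `50`, `g = 9`, F16; `m = 40`: `90`, `g = 19`, F22; `m = 100`: `210`, `g = 49`; `m = 140`: `290`, `g = 69`).

## The carrier (family form)

`![A₂₀, A₄, ⨁_i (A_i ⊕ A′_i), ⨁_j C_j]` over `Fin 4` (= `vecCons A₂₀` of the F24 carrier): `A₂₀` a realisation of the lower-half type of `ℚ(ζ_{20})`;
`A₄`, `A_i` (`d_i ∣ M` odd `> 1`, distinct), `A′_i` (`2d_i`), `C_j` (`4 ∣ e_j ≥ 8`, `e_j ∉ {12, 20, 24, 60}`, distinct) as in F24.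

## What is proved

§1 **`orthogonal_fourDvd_twenty`** (`Y_e ⟂ Y_{20}` for every non-exceptional `4 ∣ e ≥ 8`); §2 **`hom_eq_zero_blocks_twentyDvd`**,
**`nonempty_endAlgebra_algEquiv_twentyDvd`**, **`finrank_endAlgebra_twentyDvd`**.

## Honest column ∕ NOT here

The curve; `60 ∣ m` (block `Y_{60}`, with `X_4 ⊕ X_{12}` and possibly `Y_{24}`); the closed forms of the sums.  `HC_CM` is not touched.

## References

* [GalleseGoodsonLombardo2024] arXiv:2405.20394 — §3 Thm. 3.0, §3.4, §3.5 Lemma 14 and the sentence following it.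
* [MumfordAV1970] D. Mumford — §19 Thm. 3 Cor. 1–2, p. 174.
* [Shimura1998] G. Shimura — §5.1 Prop. 3, 4, 6, §8.3 Prop. 28.
* [MilneCM2006] J. S. Milne — Ch. I §1 Prop. 1.18 (c), §3 Prop. 3.13.

## Provenance

Cell `pub-hodgecm2` (COR-CM), KEPT Literature lane `lit-deligne-3` gen 52 (claim GGL24-TWENTY-DVD; count-neutral, own lane).
-/

noncomputable section

open CategoryTheory CategoryTheory.Limits NumberField Module

namespace Literature.AlgebraicGeometry.ComplexMultiplication

open Literature.AlgebraicGeometry.Motives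
open Literature.AlgebraicGeometry.HodgeTheory (complexBetti)
open Literature.NumberTheory.ComplexMultiplication

namespace HyperellipticJacobian

open Literature.AlgebraicGeometry.Pohlmann1968 Literature.AlgebraicGeometry.Pohlmann1968.Cyclotomic

/-! ## §1 The `Y_{20}` column in family form -/

section TwentyColumn

variable {d : ℕ} [NeZero d] {K : Type} [Field K] [NumberField K] [IsCyclotomicExtension {d} ℚ K] {Φ : CMType K}
  {A : AbelianVariety ℂ} {ι : 𝓞 K →+* End A} {θ : K →+* Module.End ℂ (complexBetti A.X 1)}
  {K' : Type} [Field K'] [NumberField K'] [IsCyclotomicExtension {20} ℚ K'] {Φ' : CMType K'}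
  {A' : AbelianVariety ℂ} {ι' : 𝓞 K' →+* End A'} {θ' : K' →+* Module.End ℂ (complexBetti A'.X 1)}

/-- **`Y_e ⟂ Y_{20}` for EVERY non-exceptional `4 ∣ e ≥ 8`** (`8 ∣ e`: `8 ∤ 20`, so a primitive `e`-th root of unity cannot lie in `x′(ℚ(ζ_{20}))`, F23;
`8 ∤ e`: `i ∈ K*(Φ_e) ∌ ℚ(√−5)`, F16): `Hom = 0` both ways.
[cite: GalleseGoodsonLombardo2024, §3 Thm. 3.0 (last statement) and §3.4] [cite: MilneCM2006, Ch. I §3 Prop. 3.13] -/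
theorem orthogonal_fourDvd_twenty (h4 : 4 ∣ d) (h8 : 8 ≤ d) (h20 : d ≠ 20) (h24 : d ≠ 24) (h60 : d ≠ 60)
    (hΦ : ∀ σ : K →+* ℂ, σ ∈ Φ.1 ↔ 2 * (expOf d K σ).val < d) (hA : IsCMTypeRealisation Φ A ι θ)
    (hΦ' : ∀ σ : K' →+* ℂ, σ ∈ Φ'.1 ↔ 2 * (expOf 20 K' σ).val < 20) (hA' : IsCMTypeRealisation Φ' A' ι' θ') :
    (∀ u : A ⟶ A', u = 0) ∧ (∀ v : A' ⟶ A, v = 0) := by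
  haveI : NeZero (20 : ℕ) := ⟨by norm_num⟩
  by_cases h8d : 8 ∣ d
  · have hnd : ¬ d ∣ 20 := fun h => absurd (h8d.trans h) (by decide)
    have h := orthogonal_fourDvd_of_eight_dvd_of_not_dvd 20 h8d h24 hΦ hA (by norm_num) hnd hA'
    exact ⟨h.1, h.2.1⟩
  · have h := orthogonal_fourDvd_twenty_of_not_eight_dvd h4 h8 h20 h60 h8d hΦ hA hΦ' hA'
    exact ⟨h.1, h.2.1⟩

end TwentyColumn

/-! ## §2 The levels `20 ∣ m`, `3 ∤ m` -/

section TwentyDvd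

variable {K₂₀ : Type} [Field K₂₀] [NumberField K₂₀] [IsCyclotomicExtension {20} ℚ K₂₀] {Φ₂₀ : CMType K₂₀}
  {A₂₀ : AbelianVariety ℂ} {ι₂₀ : 𝓞 K₂₀ →+* End A₂₀} {θ₂₀ : K₂₀ →+* Module.End ℂ (complexBetti A₂₀.X 1)}
  {K₄ : Type} [Field K₄] [NumberField K₄] [IsCyclotomicExtension {4} ℚ K₄] {Φ₄ : CMType K₄}
  {A₄ : AbelianVariety ℂ} {ι₄ : 𝓞 K₄ →+* End A₄} {θ₄ : K₄ →+* Module.End ℂ (complexBetti A₄.X 1)}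
  {k₁ : ℕ} {lev₁ : Fin (k₁ + 1) → ℕ} [∀ i, NeZero (lev₁ i)] [∀ i, NeZero (2 * lev₁ i)]
  {K : Fin (k₁ + 1) → Type} [∀ i, Field (K i)] [∀ i, NumberField (K i)] [∀ i, IsCyclotomicExtension {lev₁ i} ℚ (K i)]
  {L : Fin (k₁ + 1) → Type} [∀ i, Field (L i)] [∀ i, NumberField (L i)] [∀ i, IsCyclotomicExtension {2 * lev₁ i} ℚ (L i)]
  {Φ : ∀ i, CMType (K i)} {ΦL : ∀ i, CMType (L i)}
  {A A' : Fin (k₁ + 1) → AbelianVariety ℂ} {ι : ∀ i, 𝓞 (K i) →+* End (A i)}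
  {θ : ∀ i, K i →+* Module.End ℂ (complexBetti (A i).X 1)} {ι' : ∀ i, 𝓞 (L i) →+* End (A' i)}
  {θ' : ∀ i, L i →+* Module.End ℂ (complexBetti (A' i).X 1)} {M : ℕ}
  {k₂ : ℕ} {lev₂ : Fin k₂ → ℕ} [∀ j, NeZero (lev₂ j)] {F : Fin k₂ → Type} [∀ j, Field (F j)] [∀ j, NumberField (F j)]
  [∀ j, IsCyclotomicExtension {lev₂ j} ℚ (F j)] {Ψ : ∀ j, CMType (F j)} {C : Fin k₂ → AbelianVariety ℂ}
  {ιC : ∀ j, 𝓞 (F j) →+* End (C j)} {θC : ∀ j, F j →+* Module.End ℂ (complexBetti (C j).X 1)}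

omit [∀ i, NeZero (lev₁ i)] [∀ i, NeZero (2 * lev₁ i)] in
/-- Divisors `d_i > 1` of an odd `M` are odd and at least `3`. [folklore] -/
private theorem odd_and_three_le₄ (hodd : Odd M) (hdvd : ∀ i, lev₁ i ∣ M) (h1 : ∀ i, 1 < lev₁ i) (i : Fin (k₁ + 1)) :
    Odd (lev₁ i) ∧ 3 ≤ lev₁ i := by
  have ho : Odd (lev₁ i) := hodd.of_dvd_nat (hdvd i)
  refine ⟨ho, ?_⟩
  obtain ⟨r, hr⟩ := ho
  have := h1 i
  omega

omit [IsCyclotomicExtension {4} ℚ K₄] in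
/-- `[ℚ(ζ_4) : ℚ] = 2`. [folklore] -/
private theorem finrank_eq_two_four₄ [IsCyclotomicExtension {4} ℚ K₄] : finrank ℚ K₄ = 2 := by
  rw [finrank_eq_totient 4 K₄]
  decide +kernel

/-- **The four parts `Y_{20}`-block, `X_4`, `⨁_i (X_{d_i} ⊕ X_{2d_i})`, `⨁_j X_{e_j}` of `J_m` (`20 ∣ m`, `3 ∤ m`) are pairwise orthogonal**: the `Y_{20}`
column (`X_4`: F16; odd ∕ twice-odd: F12; `Y_e`: §1) on top of F24 `hom_eq_zero_blocks_genericComposite`.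
[cite: GalleseGoodsonLombardo2024, §3 Thm. 3.0 (last statement)] [cite: MilneCM2006, Ch. I §3 Prop. 3.13] -/
theorem hom_eq_zero_blocks_twentyDvd (hodd : Odd M) (hdvd : ∀ i, lev₁ i ∣ M) (h1 : ∀ i, 1 < lev₁ i)
    (hΦ : ∀ i (σ : K i →+* ℂ), σ ∈ (Φ i).1 ↔ 2 * (expOf (lev₁ i) (K i) σ).val < lev₁ i)
    (hΦL : ∀ i (σ : L i →+* ℂ), σ ∈ (ΦL i).1 ↔ 2 * (expOf (2 * lev₁ i) (L i) σ).val < 2 * lev₁ i)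
    (hA : ∀ i, IsCMTypeRealisation (Φ i) (A i) (ι i) (θ i)) (hA' : ∀ i, IsCMTypeRealisation (ΦL i) (A' i) (ι' i) (θ' i))
    (hA₄ : IsCMTypeRealisation Φ₄ A₄ ι₄ θ₄)
    (hΦ₂₀ : ∀ σ : K₂₀ →+* ℂ, σ ∈ Φ₂₀.1 ↔ 2 * (expOf 20 K₂₀ σ).val < 20) (hA₂₀ : IsCMTypeRealisation Φ₂₀ A₂₀ ι₂₀ θ₂₀)
    (h4 : ∀ j, 4 ∣ lev₂ j) (h8 : ∀ j, 8 ≤ lev₂ j) (h12 : ∀ j, lev₂ j ≠ 12) (h20 : ∀ j, lev₂ j ≠ 20) (h24 : ∀ j, lev₂ j ≠ 24)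
    (h60 : ∀ j, lev₂ j ≠ 60) (hΨ : ∀ j (σ : F j →+* ℂ), σ ∈ (Ψ j).1 ↔ 2 * (expOf (lev₂ j) (F j) σ).val < lev₂ j)
    (hC : ∀ j, IsCMTypeRealisation (Ψ j) (C j) (ιC j) (θC j)) :
    ∀ a b : Fin 4, a ≠ b →
      ∀ f : (![A₂₀, A₄, ⨁ fun i => ⨁ fun l : Fin 2 => (![A i, A' i] : Fin 2 → AbelianVariety ℂ) l, ⨁ C] : Fin 4 → AbelianVariety ℂ) a ⟶
        (![A₂₀, A₄, ⨁ fun i => ⨁ fun l : Fin 2 => (![A i, A' i] : Fin 2 → AbelianVariety ℂ) l, ⨁ C] : Fin 4 → AbelianVariety ℂ) b, f = 0 := by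
  classical
  have ho : ∀ i, Odd (lev₁ i) ∧ 3 ≤ lev₁ i := odd_and_three_le₄ hodd hdvd h1
  -- the `Y_{20}` column
  have o4 := orthogonal_four_twenty hA₄ hΦ₂₀ hA₂₀
  have oA : ∀ i, (∀ u : A i ⟶ A₂₀, u = 0) ∧ (∀ v : A₂₀ ⟶ A i, v = 0) := fun i =>
    let h := orthogonal_odd_twenty (ho i).1 (ho i).2 (hΦ i) (hA i) hΦ₂₀ hA₂₀
    ⟨h.1, h.2.1⟩
  have oA' : ∀ i, (∀ u : A' i ⟶ A₂₀, u = 0) ∧ (∀ v : A₂₀ ⟶ A' i, v = 0) := fun i =>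
    let h := orthogonal_twiceOdd_twenty (ho i).1 (ho i).2 (hΦL i) (hA' i) hΦ₂₀ hA₂₀
    ⟨h.1, h.2.1⟩
  have oC : ∀ j, (∀ u : C j ⟶ A₂₀, u = 0) ∧ (∀ v : A₂₀ ⟶ C j, v = 0) := fun j =>
    orthogonal_fourDvd_twenty (h4 j) (h8 j) (h20 j) (h24 j) (h60 j) (hΨ j) (hC j) hΦ₂₀ hA₂₀
  -- block-level relations of `A₂₀`
  have b0 : (∀ u : A₂₀ ⟶ A₄, u = 0) ∧ (∀ v : A₄ ⟶ A₂₀, v = 0) := ⟨o4.2.1, o4.1⟩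
  have b1 : (∀ u : A₂₀ ⟶ ⨁ fun i => ⨁ fun l : Fin 2 => (![A i, A' i] : Fin 2 → AbelianVariety ℂ) l, u = 0) ∧
      (∀ v : (⨁ fun i => ⨁ fun l : Fin 2 => (![A i, A' i] : Fin 2 → AbelianVariety ℂ) l) ⟶ A₂₀, v = 0) :=
    ⟨fun u => hom_to_biproduct_eq_zero (fun i w => hom_to_pair_eq_zero (oA i).2 (oA' i).2 w) u,
      fun v => hom_from_biproduct_eq_zero (fun i w => hom_from_pair_eq_zero (oA i).1 (oA' i).1 w) v⟩
  have b2 : (∀ u : A₂₀ ⟶ ⨁ C, u = 0) ∧ (∀ v : (⨁ C) ⟶ A₂₀, v = 0) :=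
    ⟨fun u => hom_to_biproduct_eq_zero (fun j w => (oC j).2 w) u, fun v => hom_from_biproduct_eq_zero (fun j w => (oC j).1 w) v⟩
  exact hom_eq_zero_vecCons (X := A₂₀)
    (F := (![A₄, ⨁ fun i => ⨁ fun l : Fin 2 => (![A i, A' i] : Fin 2 → AbelianVariety ℂ) l, ⨁ C] : Fin 3 → AbelianVariety ℂ))
    (Fin.cons b0 (Fin.cons b1 (Fin.cons b2 finZeroElim)))
    (hom_eq_zero_blocks_genericComposite hodd hdvd h1 hΦ hΦL hA hA' hA₄ h4 h8 h12 h20 h24 h60 hΨ hC)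

/-- The product of four algebras indexed by `Fin 4`. [folklore] -/
private theorem nonempty_pi_fin_four_algEquiv_prod'' (T : Fin 4 → Type) [∀ i, Ring (T i)] [∀ i, Algebra ℚ (T i)] :
    Nonempty ((∀ i, T i) ≃ₐ[ℚ] T 0 × (T 1 × (T 2 × T 3))) := by
  refine ⟨AlgEquiv.ofBijective
    ((Pi.evalAlgHom ℚ T 0).prod ((Pi.evalAlgHom ℚ T 1).prod ((Pi.evalAlgHom ℚ T 2).prod (Pi.evalAlgHom ℚ T 3))))
    ⟨fun f g h => ?_, fun x => ?_⟩⟩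
  · simp only [AlgHom.prod_apply, Pi.evalAlgHom_apply, Prod.mk.injEq] at h
    funext i
    match i with
    | ⟨0, _⟩ => exact h.1
    | ⟨1, _⟩ => exact h.2.1
    | ⟨2, _⟩ => exact h.2.2.1
    | ⟨3, _⟩ => exact h.2.2.2
  · exact ⟨Fin.cons x.1 (Fin.cons x.2.1 (Fin.cons x.2.2.1 (Fin.cons x.2.2.2 finZeroElim))), rfl⟩

/-- **GGL THM. 3.0 + LEMMA 14 at the levels `20 ∣ m`, `3 ∤ m` (family form):
`End⁰(J_m) ≃ₐ[ℚ] Mat₄(ℚ(r₂₀)) × (ℚ(ζ_4) × ((∏_i Mat₂(ℚ(ζ_{d_i}))) × ∏_j Mat₂(ℚ(ζ_{e_j} − ζ_{e_j}⁻¹))))`**, `r₂₀ = ζ + ζ³ + ζ⁷ + ζ⁹`, `r₂₀² = −5`, on the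
carrier `![A₂₀, A₄, ⨁_i (A_i ⊕ A′_i), ⨁_j C_j]` (Lemma 14 (3) for the `Y_{20}`-block, F24 for the rest).
[cite: GalleseGoodsonLombardo2024, §3.5 Lemma 14 and the sentence following it; §3 Thm. 3.0 (4), (5), last statement; §3.4]
[cite: MumfordAV1970, §19 Cor. 2 of Thm. 3 and p. 174] [cite: Shimura1998, §5.1 Prop. 3, 4 (proofs) and Prop. 6] -/
theorem nonempty_endAlgebra_algEquiv_twentyDvd [NeZero M] (hodd : Odd M) (hdvd : ∀ i, lev₁ i ∣ M) (hinj₁ : Function.Injective lev₁)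
    (h1 : ∀ i, 1 < lev₁ i) (hΦ : ∀ i (σ : K i →+* ℂ), σ ∈ (Φ i).1 ↔ 2 * (expOf (lev₁ i) (K i) σ).val < lev₁ i)
    (hΦL : ∀ i (σ : L i →+* ℂ), σ ∈ (ΦL i).1 ↔ 2 * (expOf (2 * lev₁ i) (L i) σ).val < 2 * lev₁ i)
    (hA : ∀ i, IsCMTypeRealisation (Φ i) (A i) (ι i) (θ i)) (hA' : ∀ i, IsCMTypeRealisation (ΦL i) (A' i) (ι' i) (θ' i))
    (hA₄ : IsCMTypeRealisation Φ₄ A₄ ι₄ θ₄)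
    (hΦ₂₀ : ∀ σ : K₂₀ →+* ℂ, σ ∈ Φ₂₀.1 ↔ 2 * (expOf 20 K₂₀ σ).val < 20) (hA₂₀ : IsCMTypeRealisation Φ₂₀ A₂₀ ι₂₀ θ₂₀)
    (h4 : ∀ j, 4 ∣ lev₂ j) (h8 : ∀ j, 8 ≤ lev₂ j) (h12 : ∀ j, lev₂ j ≠ 12) (h20 : ∀ j, lev₂ j ≠ 20) (h24 : ∀ j, lev₂ j ≠ 24)
    (h60 : ∀ j, lev₂ j ≠ 60) (hinj₂ : Function.Injective lev₂)
    (hΨ : ∀ j (σ : F j →+* ℂ), σ ∈ (Ψ j).1 ↔ 2 * (expOf (lev₂ j) (F j) σ).val < lev₂ j)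
    (hC : ∀ j, IsCMTypeRealisation (Ψ j) (C j) (ιC j) (θC j)) :
    Nonempty ((⨁ fun a : Fin 4 =>
        (![A₂₀, A₄, ⨁ fun i => ⨁ fun l : Fin 2 => (![A i, A' i] : Fin 2 → AbelianVariety ℂ) l, ⨁ C] : Fin 4 → AbelianVariety ℂ) a).endAlgebra ≃ₐ[ℚ]
      Matrix (Fin 4) (Fin 4) (IntermediateField.adjoin ℚ {zetaOf 20 K₂₀ + zetaOf 20 K₂₀ ^ 3 + zetaOf 20 K₂₀ ^ 7 + zetaOf 20 K₂₀ ^ 9}) ×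
        (K₄ × ((∀ i, Matrix (Fin 2) (Fin 2) (K i)) ×
          (∀ j, Matrix (Fin 2) (Fin 2) (IntermediateField.adjoin ℚ {zetaOf (lev₂ j) (F j) - (zetaOf (lev₂ j) (F j))⁻¹}))))) := by
  classical
  obtain ⟨E, -⟩ := AbelianVariety.nonempty_algEquiv_endAlgebra_biproduct_pi
    (A := fun a : Fin 4 => (![A₂₀, A₄, ⨁ fun i => ⨁ fun l : Fin 2 => (![A i, A' i] : Fin 2 → AbelianVariety ℂ) l, ⨁ C] :
      Fin 4 → AbelianVariety ℂ) a)
    (hom_eq_zero_blocks_twentyDvd hodd hdvd h1 hΦ hΦL hA hA' hA₄ hΦ₂₀ hA₂₀ h4 h8 h12 h20 h24 h60 hΨ hC)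
  obtain ⟨P⟩ := nonempty_pi_fin_four_algEquiv_prod''
    (fun a : Fin 4 => ((![A₂₀, A₄, ⨁ fun i => ⨁ fun l : Fin 2 => (![A i, A' i] : Fin 2 → AbelianVariety ℂ) l, ⨁ C] :
      Fin 4 → AbelianVariety ℂ) a).endAlgebra)
  obtain ⟨-, -, -, ⟨e₃⟩, -⟩ := nonempty_matrix_four_algEquiv_endAlgebra_twenty Φ₂₀ hΦ₂₀ hA₂₀
  obtain ⟨e₀⟩ : Nonempty (A₄.endAlgebra ≃ₐ[ℚ] K₄) :=
    hA₄.nonempty_endAlgebra_algEquiv_of_primitive (CMTypeLattice.primitive_of_finrank_eq_two Φ₄ finrank_eq_two_four₄)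
  obtain ⟨e₁⟩ := nonempty_endAlgebra_algEquiv_pi_matrix_twiceOdd hodd hdvd hinj₁ h1 hΦ hΦL hA hA'
  obtain ⟨e₂⟩ := nonempty_endAlgebra_biproduct_algEquiv_pi_fourDvd h4 h8 h20 h24 h60 hinj₂ hΨ hC
  exact ⟨(E.trans P).trans (AlgEquiv.prodCongr e₃.symm (AlgEquiv.prodCongr e₀ (AlgEquiv.prodCongr e₁ e₂)))⟩

/-- **Dimension count at the levels `20 ∣ m`, `3 ∤ m`: `dim_ℚ End⁰(J) = 34 + 4 Σ_i φ(d_i) + 2 Σ_j φ(e_j)` and `2 dim J = 10 + 2 Σ_i φ(d_i) + Σ_j φ(e_j)`**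
(`m = 20`: `50`, `g = 9` (F16); `m = 40`: `90`, `g = 19` (F22); `m = 100`: `210`, `g = 49`; `m = 140`: `290`, `g = 69`).
[cite: GalleseGoodsonLombardo2024, §3 Thm. 3.0 («dim X_d = φ(d)/2») and §3.5 Lemma 14] [cite: MumfordAV1970, §19 Cor. 2 of Thm. 3] -/
theorem finrank_endAlgebra_twentyDvd [NeZero M] (hodd : Odd M) (hdvd : ∀ i, lev₁ i ∣ M) (hinj₁ : Function.Injective lev₁)
    (h1 : ∀ i, 1 < lev₁ i) (hΦ : ∀ i (σ : K i →+* ℂ), σ ∈ (Φ i).1 ↔ 2 * (expOf (lev₁ i) (K i) σ).val < lev₁ i)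
    (hΦL : ∀ i (σ : L i →+* ℂ), σ ∈ (ΦL i).1 ↔ 2 * (expOf (2 * lev₁ i) (L i) σ).val < 2 * lev₁ i)
    (hA : ∀ i, IsCMTypeRealisation (Φ i) (A i) (ι i) (θ i)) (hA' : ∀ i, IsCMTypeRealisation (ΦL i) (A' i) (ι' i) (θ' i))
    (hA₄ : IsCMTypeRealisation Φ₄ A₄ ι₄ θ₄)
    (hΦ₂₀ : ∀ σ : K₂₀ →+* ℂ, σ ∈ Φ₂₀.1 ↔ 2 * (expOf 20 K₂₀ σ).val < 20) (hA₂₀ : IsCMTypeRealisation Φ₂₀ A₂₀ ι₂₀ θ₂₀)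
    (h4 : ∀ j, 4 ∣ lev₂ j) (h8 : ∀ j, 8 ≤ lev₂ j) (h12 : ∀ j, lev₂ j ≠ 12) (h20 : ∀ j, lev₂ j ≠ 20) (h24 : ∀ j, lev₂ j ≠ 24)
    (h60 : ∀ j, lev₂ j ≠ 60) (hinj₂ : Function.Injective lev₂)
    (hΨ : ∀ j (σ : F j →+* ℂ), σ ∈ (Ψ j).1 ↔ 2 * (expOf (lev₂ j) (F j) σ).val < lev₂ j)
    (hC : ∀ j, IsCMTypeRealisation (Ψ j) (C j) (ιC j) (θC j)) :
    finrank ℚ (⨁ fun a : Fin 4 =>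
        (![A₂₀, A₄, ⨁ fun i => ⨁ fun l : Fin 2 => (![A i, A' i] : Fin 2 → AbelianVariety ℂ) l, ⨁ C] : Fin 4 → AbelianVariety ℂ) a).endAlgebra =
      34 + 4 * ∑ i, Nat.totient (lev₁ i) + 2 * ∑ j, Nat.totient (lev₂ j) ∧
    2 * (⨁ fun a : Fin 4 =>
        (![A₂₀, A₄, ⨁ fun i => ⨁ fun l : Fin 2 => (![A i, A' i] : Fin 2 → AbelianVariety ℂ) l, ⨁ C] : Fin 4 → AbelianVariety ℂ) a).dim =
      10 + 2 * ∑ i, Nat.totient (lev₁ i) + ∑ j, Nat.totient (lev₂ j) := by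
  classical
  obtain ⟨hfr₃, hdim₃⟩ := finrank_endAlgebra_genericComposite hodd hdvd hinj₁ h1 hΦ hΦL hA hA' hA₄ h4 h8 h12 h20 h24 h60 hinj₂ hΨ hC
  obtain ⟨hd₂₀, -, -, ⟨e₃⟩, -, hfr₂₀, -⟩ := nonempty_matrix_four_algEquiv_endAlgebra_twenty Φ₂₀ hΦ₂₀ hA₂₀
  refine ⟨?_, ?_⟩
  · obtain ⟨e⟩ := nonempty_endAlgebra_algEquiv_twentyDvd hodd hdvd hinj₁ h1 hΦ hΦL hA hA' hA₄ hΦ₂₀ hA₂₀ h4 h8 h12 h20 h24 h60 hinj₂ hΨ hC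
    obtain ⟨e'⟩ := nonempty_endAlgebra_algEquiv_genericComposite hodd hdvd hinj₁ h1 hΦ hΦL hA hA' hA₄ h4 h8 h12 h20 h24 h60 hinj₂ hΨ hC
    haveI : ∀ j, FiniteDimensional ℚ (IntermediateField.adjoin ℚ {zetaOf (lev₂ j) (F j) - (zetaOf (lev₂ j) (F j))⁻¹}) := fun j =>
      IntermediateField.finiteDimensional_left _
    haveI : ∀ j, Module.Finite ℚ (Matrix (Fin 2) (Fin 2)
        (IntermediateField.adjoin ℚ {zetaOf (lev₂ j) (F j) - (zetaOf (lev₂ j) (F j))⁻¹})) := fun j => Module.Finite.matrix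
    haveI : ∀ j, Module.Free ℚ (Matrix (Fin 2) (Fin 2)
        (IntermediateField.adjoin ℚ {zetaOf (lev₂ j) (F j) - (zetaOf (lev₂ j) (F j))⁻¹})) := fun j => inferInstance
    haveI : ∀ i, Module.Finite ℚ (Matrix (Fin 2) (Fin 2) (K i)) := fun i => Module.Finite.matrix
    haveI : ∀ i, Module.Free ℚ (Matrix (Fin 2) (Fin 2) (K i)) := fun i => inferInstance
    haveI : Module.Finite ℚ (∀ j, Matrix (Fin 2) (Fin 2)
        (IntermediateField.adjoin ℚ {zetaOf (lev₂ j) (F j) - (zetaOf (lev₂ j) (F j))⁻¹})) := inferInstance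
    haveI : Module.Free ℚ (∀ j, Matrix (Fin 2) (Fin 2)
        (IntermediateField.adjoin ℚ {zetaOf (lev₂ j) (F j) - (zetaOf (lev₂ j) (F j))⁻¹})) := inferInstance
    haveI : Module.Finite ℚ (∀ i, Matrix (Fin 2) (Fin 2) (K i)) := inferInstance
    haveI : Module.Free ℚ (∀ i, Matrix (Fin 2) (Fin 2) (K i)) := inferInstance
    haveI : Module.Finite ℚ ((∀ i, Matrix (Fin 2) (Fin 2) (K i)) × (∀ j, Matrix (Fin 2) (Fin 2)
        (IntermediateField.adjoin ℚ {zetaOf (lev₂ j) (F j) - (zetaOf (lev₂ j) (F j))⁻¹}))) := inferInstance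
    haveI : Module.Free ℚ ((∀ i, Matrix (Fin 2) (Fin 2) (K i)) × (∀ j, Matrix (Fin 2) (Fin 2)
        (IntermediateField.adjoin ℚ {zetaOf (lev₂ j) (F j) - (zetaOf (lev₂ j) (F j))⁻¹}))) := inferInstance
    haveI : Module.Finite ℚ (K₄ × ((∀ i, Matrix (Fin 2) (Fin 2) (K i)) × (∀ j, Matrix (Fin 2) (Fin 2)
        (IntermediateField.adjoin ℚ {zetaOf (lev₂ j) (F j) - (zetaOf (lev₂ j) (F j))⁻¹})))) := inferInstance
    haveI : Module.Free ℚ (K₄ × ((∀ i, Matrix (Fin 2) (Fin 2) (K i)) × (∀ j, Matrix (Fin 2) (Fin 2)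
        (IntermediateField.adjoin ℚ {zetaOf (lev₂ j) (F j) - (zetaOf (lev₂ j) (F j))⁻¹})))) := inferInstance
    haveI : FiniteDimensional ℚ (IntermediateField.adjoin ℚ {zetaOf 20 K₂₀ + zetaOf 20 K₂₀ ^ 3 + zetaOf 20 K₂₀ ^ 7 + zetaOf 20 K₂₀ ^ 9}) :=
      IntermediateField.finiteDimensional_left _
    haveI : Module.Finite ℚ (Matrix (Fin 4) (Fin 4)
        (IntermediateField.adjoin ℚ {zetaOf 20 K₂₀ + zetaOf 20 K₂₀ ^ 3 + zetaOf 20 K₂₀ ^ 7 + zetaOf 20 K₂₀ ^ 9})) := Module.Finite.matrix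
    haveI : Module.Free ℚ (Matrix (Fin 4) (Fin 4)
        (IntermediateField.adjoin ℚ {zetaOf 20 K₂₀ + zetaOf 20 K₂₀ ^ 3 + zetaOf 20 K₂₀ ^ 7 + zetaOf 20 K₂₀ ^ 9})) := inferInstance
    have hrest : finrank ℚ (K₄ × ((∀ i, Matrix (Fin 2) (Fin 2) (K i)) × (∀ j, Matrix (Fin 2) (Fin 2)
        (IntermediateField.adjoin ℚ {zetaOf (lev₂ j) (F j) - (zetaOf (lev₂ j) (F j))⁻¹})))) =
        2 + 4 * ∑ i, Nat.totient (lev₁ i) + 2 * ∑ j, Nat.totient (lev₂ j) := by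
      rw [← e'.toLinearEquiv.finrank_eq, hfr₃]
    have hfirst : finrank ℚ (Matrix (Fin 4) (Fin 4)
        (IntermediateField.adjoin ℚ {zetaOf 20 K₂₀ + zetaOf 20 K₂₀ ^ 3 + zetaOf 20 K₂₀ ^ 7 + zetaOf 20 K₂₀ ^ 9})) = 32 := by
      rw [e₃.toLinearEquiv.finrank_eq, hfr₂₀]
    rw [e.toLinearEquiv.finrank_eq, Module.finrank_prod, hfirst, hrest]
    omega
  · have h3 : 2 * (⨁ fun a : Fin 3 => (![A₄, ⨁ fun i => ⨁ fun l : Fin 2 => (![A i, A' i] : Fin 2 → AbelianVariety ℂ) l, ⨁ C] :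
        Fin 3 → AbelianVariety ℂ) a).dim =
        2 * (A₄.dim + (⨁ fun i => ⨁ fun l : Fin 2 => (![A i, A' i] : Fin 2 → AbelianVariety ℂ) l).dim + (⨁ C).dim) := by
      rw [AbelianVariety.dim_biproduct, Fin.sum_univ_three]
      rfl
    rw [AbelianVariety.dim_biproduct, Fin.sum_univ_four]
    show 2 * (A₂₀.dim + A₄.dim + (⨁ fun i => ⨁ fun l : Fin 2 => (![A i, A' i] : Fin 2 → AbelianVariety ℂ) l).dim + (⨁ C).dim) =
      10 + 2 * ∑ i, Nat.totient (lev₁ i) + ∑ j, Nat.totient (lev₂ j)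
    rw [hd₂₀]
    omega

end TwentyDvd

end HyperellipticJacobian

end Literature.AlgebraicGeometry.ComplexMultiplication

end
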